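import Literature.NumberTheory.GaloisRepresentations.DiscreteModuleInverseLimitH1
import Literature.NumberTheory.GaloisRepresentations.LocalKummerTorsion
import Literature.NumberTheory.GaloisRepresentations.LocalGlobalCohomologyFiniteProofs
import Literature.NumberTheory.GaloisRepresentations.LocalDualityTheorem
import HarnessLib

/-!
# The Tate module `Ẑ(1) = lim_n μ_n(K̄)` as an inverse limit of discrete Galois modules, and
# `H²(G_K, Ẑ(1)) ≅ lim_n H²(G_K, μ_n)` for a `p`-adic local field

For a field `K`, the roots of unity `μ_n(K̄)` (`DiscreteGaloisModule.mu K n`, the tree's discrete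
`Γ_K`-modules on `MuCarrier K n = Additive (rootsOfUnity n K̄)`) form an inverse system over `ℕ≥1`
ordered by divisibility, with the power maps `μ_m ↠ μ_n`, `ζ ↦ ζ^{m/n}` (`n ∣ m`) as transition maps
("`Ẑ(1) = lim_n μ_n`", Neukirch–Schmidt–Wingberg (7.3.x)/(2.7.5); [AbsTopIII] Def. 3.1 (v) p. 69
"`μ_Ẑ(−) := Hom(ℚ/ℤ, μ_{ℚ/ℤ}(−))`").  This file

* builds that system `muSystem K : DiscreteInvSystem Γ_K (fun n : ℕ+ => MuCarrier K n)` and its limit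
  representation `Ẑ(1)(K̄) := (muSystem K).limitRep` (jointly continuous, profinite topology), proves the
  transition maps SURJECTIVE (`K̄` is algebraically closed) and exhibits the cofinal factorial chain
  `n ↦ (n+1)!`;
* concludes, from the trunk theorems `DiscreteInvSystem.continuousCohomologyOneLimitEquiv` /
  `continuousCohomologyTwoLimitEquiv` (NSW II §7 Thm. 2.7.5), the isomorphisms
  `H¹_cont(G_K, Ẑ(1)) ≃+ lim_n H¹(G_K, μ_n)` for every field of characteristic `0`
  (`continuousCohomologyOneTateModuleEquiv`; the `μ_n` are finite) and
  `H²_cont(G_K, Ẑ(1)) ≃+ lim_n H²(G_K, μ_n)` for a non-archimedean local field of characteristic `0`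
  (`continuousCohomologyTwoTateModuleEquiv`; `Z¹(G_K, μ_n)` is finite because `H¹(G_K, μ_n)` is, tree
  `finite_galoisCohomology_one_of_isNonarchimedeanLocalField`, Serre CG II §5.2 Prop. 14).

Definitions with bodies and theorems; no named fact, no `sorry`.  Cell abc-iut, layer L4, towards
[AbsTopIII] Cor. 1.10 (i)(a).
-/

noncomputable section

open CategoryTheory Function
open Field IsNonarchimedeanLocalField ValuativeRel

universe u

namespace Literature.NumberTheory.GaloisRepresentations

open _root_.TopRep _root_.ContRepresentation _root_.ContinuousCohomology DiscreteGaloisModule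

section PowMaps

variable (K : Type u) [Field K] {n m : ℕ}

/-- **The power map `μ_m(K̄) → μ_n(K̄)`, `ζ ↦ ζ^{m/n}`** for `n ∣ m` (transition map of the inverse
system `Ẑ(1) = lim_n μ_n`). [cite: NeukirchSchmidtWingberg2008, II §7 Thm 2.7.5] -/
def muPowMap (h : n ∣ m) : MuCarrier K m →+ MuCarrier K n where
  toFun v := muOfUnit K n (muVal K m v ^ (m / n))
    (by rw [← pow_mul, Nat.div_mul_cancel h, muVal_pow_eq_one])
  map_zero' := muVal_injective K n (by simp)
  map_add' v w := muVal_injective K n (by simp [mul_pow])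

/-- `muPowMap` on underlying units. [cite: NeukirchSchmidtWingberg2008, II §7 Thm 2.7.5] -/
@[simp] theorem muVal_muPowMap (h : n ∣ m) (v : MuCarrier K m) :
    muVal K n (muPowMap K h v) = muVal K m v ^ (m / n) := rfl

/-- Exponent bookkeeping: `(c/b)·(b/a) = c/a` for `a ∣ b ∣ c`, `b ≠ 0`. [folklore] -/
private theorem div_mul_div_cancel_of_dvd {a b c : ℕ} (hb : b ≠ 0) (h₁ : a ∣ b) (h₂ : b ∣ c) :
    c / b * (b / a) = c / a := by
  obtain ⟨j, rfl⟩ := h₁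
  obtain ⟨k, rfl⟩ := h₂
  rcases Nat.eq_zero_or_pos a with rfl | ha
  · simp at hb
  · rw [Nat.mul_div_cancel_left k (Nat.pos_of_ne_zero hb), Nat.mul_div_cancel_left j ha, mul_assoc,
      Nat.mul_div_cancel_left (j * k) ha, mul_comm]

end PowMaps

section System

variable (K : Type u) [Field K]

/-- **The inverse system `(μ_n(K̄))_{n ≥ 1}`** of discrete `Γ_K`-modules over `ℕ≥1` ordered by
divisibility, with the power maps as transition maps (`abbrev`, so that `(muSystem K).ρ n` unfolds to
`mu K n` reducibly). [cite: NeukirchSchmidtWingberg2008, II §7 Thm 2.7.5] -/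
abbrev muSystem : DiscreteInvSystem (absoluteGaloisGroup K) (fun n : ℕ+ => MuCarrier K n) where
  le n m := (n : ℕ) ∣ m
  le_refl n := dvd_rfl
  le_trans h₁ h₂ := dvd_trans h₁ h₂
  ρ n := mu K n
  red h := muPowMap K h
  red_smul h g x := muVal_injective K _ (by simp [smul_pow'])
  red_refl n x := muVal_injective K _ (by simp)
  red_trans {a b c} h₁ h₂ x := muVal_injective K _ (by
    simp only [muVal_muPowMap, ← pow_mul]
    rw [div_mul_div_cancel_of_dvd b.ne_zero h₁ h₂])

/-- The order relation of `muSystem` is divisibility. [cite: NeukirchSchmidtWingberg2008, II §7 Thm 2.7.5] -/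
@[simp] theorem muSystem_le (n m : ℕ+) : (muSystem K).le n m ↔ (n : ℕ) ∣ m := Iff.rfl

/-- The modules of `muSystem` are the `μ_n`. [cite: NeukirchSchmidtWingberg2008, II §7 Thm 2.7.5] -/
@[simp] theorem muSystem_ρ (n : ℕ+) : (muSystem K).ρ n = mu K n := rfl

/-- The transition maps of `muSystem` are the power maps. [cite: NeukirchSchmidtWingberg2008, II §7 Thm 2.7.5] -/
@[simp] theorem muSystem_red {n m : ℕ+} (h : (n : ℕ) ∣ m) (v : MuCarrier K m) :
    (muSystem K).red h v = muPowMap K h v := rfl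

/-- **The transition maps `μ_m ↠ μ_n` are surjective** (`K̄` is algebraically closed: every `n`-th
root of unity has an `m/n`-th root, which is an `m`-th root of unity).
[cite: NeukirchSchmidtWingberg2008, II §7 Thm 2.7.5] -/
theorem muSystem_red_surjective {n m : ℕ+} (h : (n : ℕ) ∣ m) :
    Surjective ((muSystem K).red h) := by
  intro v
  have hd : 0 < (m : ℕ) / n := Nat.div_pos (Nat.le_of_dvd m.pos h) n.pos
  obtain ⟨x, hx⟩ := IsAlgClosed.exists_pow_nat_eq ((muVal K n v : (AlgebraicClosure K)ˣ) :
    AlgebraicClosure K) hd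
  have hx0 : x ≠ 0 := by
    rintro rfl
    rw [zero_pow hd.ne'] at hx
    exact (muVal K n v).ne_zero hx.symm
  have hum : Units.mk0 x hx0 ^ (m : ℕ) = 1 := by
    ext
    rw [Units.val_pow_eq_pow_val, Units.val_mk0, ← Nat.div_mul_cancel h, pow_mul, hx,
      ← Units.val_pow_eq_pow_val, muVal_pow_eq_one]
  refine ⟨muOfUnit K m (Units.mk0 x hx0) hum, muVal_injective K n (Units.ext ?_)⟩
  rw [muSystem_red, muVal_muPowMap, muVal_muOfUnit, Units.val_pow_eq_pow_val, Units.val_mk0, hx]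

/-- **The factorial chain `i ↦ (i+1)!`** is cofinal in `ℕ≥1` ordered by divisibility.
[cite: NeukirchSchmidtWingberg2008, II §7 Thm 2.7.5] -/
def muSystemChain : (muSystem K).CofinalChain where
  seq i := ⟨(i + 1).factorial, Nat.factorial_pos _⟩
  le_succ _ := Nat.factorial_dvd_factorial (Nat.le_succ _)
  cofinal n := ⟨n, Nat.dvd_factorial n.pos (Nat.le_succ n)⟩

/-- **`Ẑ(1)(K̄) := lim_n μ_n(K̄)`**, the Tate module of the roots of unity, as a jointly continuous
representation of `Γ_K` (profinite topology). [cite: NeukirchSchmidtWingberg2008, II §7 Thm 2.7.5] -/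
abbrev tateModuleMu : ContinuousRep (absoluteGaloisGroup K) ℤ (muSystem K).limit :=
  (muSystem K).limitRep

end System

/-! ### `H¹(G_K, Ẑ(1)) ≅ lim_n H¹(G_K, μ_n)` for every field of characteristic `0` -/

section CharZero

variable (K : Type u) [Field K] [CharZero K]

/-- **`H¹_cont(G_K, Ẑ(1)) ≃ lim_n H¹(G_K, μ_n)`** for a field `K` of characteristic `0` (NSW II §7
Thm. 2.7.5 in degree `1`: the `μ_n(K̄)` are finite), with coordinates the maps induced by the projections
`Ẑ(1) → μ_n`. [cite: NeukirchSchmidtWingberg2008, II §7 Thm 2.7.5] -/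
def continuousCohomologyOneTateModuleEquiv :
    continuousCohomology 1 (tateModuleMu K).toTopRep ≃+ (muSystem K).cohomologyLimit 1 :=
  (muSystem K).continuousCohomologyOneLimitEquiv (muSystemChain K)
    (fun h => muSystem_red_surjective K h) fun n =>
      haveI : NeZero (n : ℕ) := NeZero.of_pos n.pos
      finite_muCarrier K n

end CharZero

/-! ### `p`-adic local fields: `H²(G_K, Ẑ(1)) ≅ lim_n H²(G_K, μ_n)` -/

section Local

variable (K : Type u) [Field K] [ValuativeRel K] [TopologicalSpace K] [IsNonarchimedeanLocalField K]
  [CharZero K]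

/-- `Z¹(G_K, μ_n)` is finite for a non-archimedean local field `K` of characteristic `0` (finite
`H¹(G_K, μ_n)`, Serre CG II §5.2 Prop. 14, and finite `μ_n`). [cite: SerreGaloisCohomology1997, II §5.2 Prop. 14] -/
theorem finite_contOneCocycles_mu (n : ℕ+) : Finite (contOneCocycles (mu K n).toTopRep) := by
  haveI : NeZero (n : ℕ) := NeZero.of_pos n.pos
  haveI : Finite (MuCarrier K n) := finite_muCarrier K n
  haveI : Finite (continuousCohomology 1 (mu K n).toTopRep) :=
    finite_galoisCohomology_one_of_isNonarchimedeanLocalField (mu K n)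
  exact finite_contOneCocycles (mu K n)

/-- **`H²_cont(G_K, Ẑ(1)) ≃ lim_n H²(G_K, μ_n)`** for a non-archimedean local field `K` of characteristic
`0` (NSW II §7 Thm. 2.7.5: the `H¹(G_K, μ_n)` are finite), with coordinates the maps induced by the
projections `Ẑ(1) → μ_n`. [cite: NeukirchSchmidtWingberg2008, II §7 Thm 2.7.5] -/
def continuousCohomologyTwoTateModuleEquiv :
    continuousCohomology 2 (tateModuleMu K).toTopRep ≃+ (muSystem K).cohomologyLimit 2 :=
  haveI : CompactSpace (absoluteGaloisGroup K) := absoluteGaloisGroup_compactSpace K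
  (muSystem K).continuousCohomologyTwoLimitEquiv (muSystemChain K)
    (fun h => muSystem_red_surjective K h) (finite_contOneCocycles_mu K)

end Local

end Literature.NumberTheory.GaloisRepresentations
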